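import Literature.Computability.AlgebraicComplexity.MatMul2smRankFiniteField
import Literature.LinearAlgebra.Matrix.RankEquivalence
import HarnessLib

/-!
# Nazarov 2023, general `2 ≤ n ≤ s`: the Theorem from the rank-class count of `L*` (Lemmas 3–7 proved)

Topic `Literature/Computability/AlgebraicComplexity`. PROVED theorems, no named facts. This file carries
out, for every `2 ≤ n ≤ s` and every finite field, the part of the printed proof of Nazarov's Theorem
(`nazarov2023_rank_matMulTensor_ge`, `Nazarov2023FiniteFieldRankBound.lean`) that follows the rank
counts: "the statement of the theorem follows from Lemmas 2–4" (p. 47 and p. 49 of the source).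

* Lemma 5 (general `n`): `G^{(n,s)} = GL_n(F) × GL_s(F)` acts on `F^{n×s}` by `A ↦ P A Q`
  (`actn`); `N(A, C) = #{(P,Q) : P A Q = C}` is constant on pairs of orbits and `R_r N_r = |G|`
  (`cntn`, `card_mul_cntn`), the orbits being the rank classes
  (`Literature.LinearAlgebra.Matrix.exists_gl_mul_mul_gl_eq_of_rank_eq`).
* Lemma 6 (general `n`): twisting a bilinear computation by `(P, Q)` multiplies every coefficient
  matrix `A_t` by `P · Q` (`twistn`, `An_twistn`).
* Lemma 3 (general `n`, type `*`): double counting and pigeonhole (`exists_goodn`): some `P L* Q`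
  contains at least `∑_r d_r q*_r` of the `A_t`.
* Lemma 4 = Lemma 7 for general `n` is `typeStar_bound_general` (`MatMul2smRankFiniteField.lean`).
* **Assembly** (`card_ge_of_count`, `nazarov2023_rank_matMulTensor_ge_of_count`): if for some
  `a > b > 0` every rank class satisfies `b · R_r^{(n,s)} ≤ a · v*_r` (`v*_r` = the number of rank-`r`
  matrices in `L*`, here the predicate `InL`), i.e. `q*_r ≥ b/a`, then
  `R(⟨n,s,m⟩) ≥ (n + s − 1)(1 + 1/(a/b − 1)) m`. With Lemma 2 (`q*_r ≥ 1/f(K,n,s)` for `n ≥ 3`; its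
  count `v*_r` is NOT formalised here — the rank-`r` totals `R_r^{(n,s)}` are
  `Literature.LinearAlgebra.Matrix.card_rank_eq_qBinomial_mul_prod`) this is exactly the Theorem for
  `s ≥ n ≥ 3`; the cases `n = 2` are proved unconditionally in `MatMul2smRankFiniteField.lean`.

## References

* A. A. Nazarov, Vestn. Mosk. Univ. Ser. 15 Vychisl. Mat. Kibern. 2023, no. 4, 41–53, §3 (Lemmas 2–7,
  proof of the Theorem on p. 49). [Nazarov2023FiniteFieldLB]
-/

noncomputable section

open Module

namespace Literature.Computability.AlgebraicComplexity

namespace Nazarov2023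

variable {F : Type*} [Field F] {n s m : ℕ} {ι : Type*} [Fintype ι]

/-! ## Lemma 5 for general `n`: the action of `GL_n × GL_s` and the numbers `N(A, C)` -/

section ActionN

variable (F) (n) (s)

/-- The group `G^{(n,s)} = GL_n(F) × GL_s(F)`. [cite: Nazarov2023FiniteFieldLB, Lemma 5] -/
abbrev Γn := GL (Fin n) F × GL (Fin s) F

variable {F} {n} {s}

/-- The action `(P, Q) · A = P A Q`. [cite: Nazarov2023FiniteFieldLB, Lemma 5] -/
def actn (g : Γn F n s) (A : Matrix (Fin n) (Fin s) F) : Matrix (Fin n) (Fin s) F :=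
  (g.1 : Matrix (Fin n) (Fin n) F) * A * (g.2 : Matrix (Fin s) (Fin s) F)

/-- Unfolding `actn`. [cite: Nazarov2023FiniteFieldLB, Lemma 5] -/
theorem actn_def (g : Γn F n s) (A : Matrix (Fin n) (Fin s) F) :
    actn g A = (g.1 : Matrix (Fin n) (Fin n) F) * A * (g.2 : Matrix (Fin s) (Fin s) F) := rfl

/-- Composition. [cite: Nazarov2023FiniteFieldLB, Lemma 5] -/
theorem actn_actn (g h : Γn F n s) (A : Matrix (Fin n) (Fin s) F) :
    actn g (actn h A) = actn (g.1 * h.1, h.2 * g.2) A := by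
  simp only [actn, Units.val_mul]
  simp only [Matrix.mul_assoc]

/-- Unit. [cite: Nazarov2023FiniteFieldLB, Lemma 5] -/
@[simp] theorem actn_one (A : Matrix (Fin n) (Fin s) F) : actn (1 : Γn F n s) A = A := by
  simp [actn]

/-- Inverse. [cite: Nazarov2023FiniteFieldLB, Lemma 5] -/
theorem actn_inv_actn (h : Γn F n s) (A : Matrix (Fin n) (Fin s) F) :
    actn (h.1⁻¹, h.2⁻¹) (actn h A) = A := by
  rw [actn_actn]
  simp only [inv_mul_cancel, mul_inv_cancel]
  exact actn_one A

/-- Inverse. [cite: Nazarov2023FiniteFieldLB, Lemma 5] -/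
theorem actn_actn_inv (h : Γn F n s) (A : Matrix (Fin n) (Fin s) F) :
    actn h (actn (h.1⁻¹, h.2⁻¹) A) = A := by
  rw [actn_actn]
  simp only [mul_inv_cancel, inv_mul_cancel]
  exact actn_one A

/-- The zero matrix is fixed. [cite: Nazarov2023FiniteFieldLB, Lemma 5] -/
@[simp] theorem actn_zero (g : Γn F n s) : actn g (0 : Matrix (Fin n) (Fin s) F) = 0 := by
  simp [actn]

/-- The action preserves the rank. [cite: Nazarov2023FiniteFieldLB, Lemma 5, 1)] -/
theorem rank_actn (g : Γn F n s) (A : Matrix (Fin n) (Fin s) F) : (actn g A).rank = A.rank := by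
  rw [actn_def, Matrix.rank_mul_eq_left_of_isUnit_det _ _ (Matrix.isUnits_det_units g.2),
    Matrix.rank_mul_eq_right_of_isUnit_det _ _ (Matrix.isUnits_det_units g.1)]

/-- **Lemma 5, 1)**: the orbits are the rank classes (transitivity). [cite: Nazarov2023FiniteFieldLB, Lemma 5, 1)] -/
theorem exists_actn_eq_of_rank_eq {A B : Matrix (Fin n) (Fin s) F} (h : B.rank = A.rank) :
    ∃ g : Γn F n s, actn g B = A := by
  obtain ⟨P, Q, hPQ⟩ := Literature.LinearAlgebra.Matrix.exists_gl_mul_mul_gl_eq_of_rank_eq B A h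
  exact ⟨(P, Q), hPQ⟩

end ActionN

section CountingN

variable [Fintype F] [DecidableEq F]

/-- `N(A, C) = #{(P, Q) : P A Q = C}`. [cite: Nazarov2023FiniteFieldLB, Lemma 5, 2)] -/
def cntn (A C : Matrix (Fin n) (Fin s) F) : ℕ :=
  (Finset.univ.filter fun g : Γn F n s => actn g A = C).card

/-- `N(P₀ A Q₀, C) = N(A, C)`. [cite: Nazarov2023FiniteFieldLB, Lemma 5 (proof)] -/
theorem cntn_actn_left (h : Γn F n s) (A C : Matrix (Fin n) (Fin s) F) : cntn (actn h A) C = cntn A C := by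
  unfold cntn
  refine Finset.card_equiv ((Equiv.mulRight h.1).prodCongr (Equiv.mulLeft h.2)) fun g => ?_
  simp only [Finset.mem_filter, Finset.mem_univ, true_and, Equiv.prodCongr_apply,
    Equiv.coe_mulRight, Equiv.coe_mulLeft, Prod.map, actn_actn]

/-- `N(A, P₀ C Q₀) = N(A, C)`. [cite: Nazarov2023FiniteFieldLB, Lemma 5 (proof)] -/
theorem cntn_actn_right (h : Γn F n s) (A C : Matrix (Fin n) (Fin s) F) : cntn A (actn h C) = cntn A C := by
  unfold cntn
  refine Finset.card_equiv ((Equiv.mulLeft h.1⁻¹).prodCongr (Equiv.mulRight h.2⁻¹)) fun g => ?_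
  simp only [Finset.mem_filter, Finset.mem_univ, true_and, Equiv.prodCongr_apply,
    Equiv.coe_mulRight, Equiv.coe_mulLeft, Prod.map]
  have e : actn (h.1⁻¹ * g.1, g.2 * h.2⁻¹) A = actn (h.1⁻¹, h.2⁻¹) (actn g A) := by rw [actn_actn]
  rw [e]
  constructor
  · intro hg
    rw [hg, actn_inv_actn]
  · intro hg
    rw [← actn_actn_inv h (actn g A), hg]

/-- `∑_C N(A, C) = |G|`. [cite: Nazarov2023FiniteFieldLB, Lemma 5 (proof)] -/
theorem sum_cntn (A : Matrix (Fin n) (Fin s) F) : ∑ C, cntn A C = Fintype.card (Γn F n s) := by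
  unfold cntn
  rw [← Finset.card_univ, Finset.card_eq_sum_card_fiberwise (f := fun g : Γn F n s => actn g A)
    (t := Finset.univ) (fun g _ => Finset.mem_coe.2 (Finset.mem_univ _))]

/-- **Lemma 5, 1)**: `N(A, C) = N(B, B)` for `A, C` of the rank of `B`. [cite: Nazarov2023FiniteFieldLB, Lemma 5, 1)] -/
theorem cntn_eq_of_rank_eq {A B C : Matrix (Fin n) (Fin s) F} (hA : A.rank = B.rank) (hC : C.rank = B.rank) :
    cntn A C = cntn B B := by
  obtain ⟨g, rfl⟩ := exists_actn_eq_of_rank_eq (A := A) (B := B) hA.symm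
  obtain ⟨h, rfl⟩ := exists_actn_eq_of_rank_eq (A := C) (B := B) hC.symm
  rw [cntn_actn_left, cntn_actn_right]

/-- **Lemma 5, 2)**: `R_r · N_r = |G|`. [cite: Nazarov2023FiniteFieldLB, Lemma 5, 2)] -/
theorem card_mul_cntn (B : Matrix (Fin n) (Fin s) F) :
    (Finset.univ.filter fun C : Matrix (Fin n) (Fin s) F => C.rank = B.rank).card * cntn B B =
      Fintype.card (Γn F n s) := by
  rw [← sum_cntn B, ← Finset.sum_filter_add_sum_filter_not Finset.univ
    (fun C : Matrix (Fin n) (Fin s) F => C.rank = B.rank)]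
  have h0 : ∑ C ∈ Finset.univ.filter (fun C : Matrix (Fin n) (Fin s) F => ¬C.rank = B.rank),
      cntn B C = 0 := by
    refine Finset.sum_eq_zero fun C hC => ?_
    have hC' := (Finset.mem_filter.1 hC).2
    unfold cntn
    rw [Finset.card_eq_zero, Finset.filter_eq_empty_iff]
    intro g _ hg
    exact hC' (by rw [← hg, rank_actn])
  rw [h0, add_zero, Finset.sum_congr rfl (fun C hC =>
    (cntn_eq_of_rank_eq rfl (Finset.mem_filter.1 hC).2 : cntn B C = cntn B B)),
    Finset.sum_const, smul_eq_mul]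

/-- Double counting. [cite: Nazarov2023FiniteFieldLB, Lemma 3 (proof)] -/
private theorem sum_card_commn (As : ι → Matrix (Fin n) (Fin s) F) (q : Matrix (Fin n) (Fin s) F → Prop)
    [DecidablePred q] :
    ∑ g : Γn F n s, (Finset.univ.filter fun t : ι => q (actn g (As t))).card =
      ∑ t : ι, (Finset.univ.filter fun g : Γn F n s => q (actn g (As t))).card := by
  simp only [Finset.card_filter]
  exact Finset.sum_comm

/-- **Lemma 3** (pigeonhole over `G^{(n,s)}`): some `(P, Q)` puts at least the average number of the
`A_t` into `L`. [cite: Nazarov2023FiniteFieldLB, Lemma 3] -/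
theorem exists_goodn (As : ι → Matrix (Fin n) (Fin s) F) (q : Matrix (Fin n) (Fin s) F → Prop)
    [DecidablePred q] :
    ∃ g : Γn F n s, ∑ t : ι, (Finset.univ.filter fun g' : Γn F n s => q (actn g' (As t))).card ≤
      (Finset.univ.filter fun t : ι => q (actn g (As t))).card * Fintype.card (Γn F n s) := by
  obtain ⟨g, -, hg⟩ := Finset.exists_le_of_sum_le (s := (Finset.univ : Finset (Γn F n s)))
    (f := fun _ => ∑ t : ι, (Finset.univ.filter fun g' : Γn F n s => q (actn g' (As t))).card)
    (g := fun g => (Finset.univ.filter fun t : ι => q (actn g (As t))).card * Fintype.card (Γn F n s))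
    Finset.univ_nonempty (le_of_eq (by
      rw [Finset.sum_const, smul_eq_mul, ← Finset.sum_mul, sum_card_commn, Finset.card_univ,
        mul_comm]))
  exact ⟨g, hg⟩

/-- `#{(P,Q) : P A Q ∈ L} = ∑_{C ∈ L} N(A, C)`. [cite: Nazarov2023FiniteFieldLB, Lemma 3 (proof)] -/
private theorem card_eq_sum_cntn (q : Matrix (Fin n) (Fin s) F → Prop) [DecidablePred q]
    (A : Matrix (Fin n) (Fin s) F) :
    (Finset.univ.filter fun g : Γn F n s => q (actn g A)).card = ∑ C ∈ Finset.univ.filter q, cntn A C := by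
  unfold cntn
  rw [Finset.card_eq_sum_card_fiberwise (f := fun g : Γn F n s => actn g A) (t := Finset.univ.filter q)
    (fun g hg => by simpa using hg)]
  refine Finset.sum_congr rfl fun C hC => ?_
  congr 1
  ext g
  simp only [Finset.mem_filter, Finset.mem_univ, true_and]
  exact ⟨fun h => h.2, fun h => ⟨by rw [h]; exact (Finset.mem_filter.1 hC).2, h⟩⟩

/-- `#{(P,Q) : P A Q ∈ L} ≥ #(L ∩ orbit of A) · N(A, A)`. [cite: Nazarov2023FiniteFieldLB, Lemma 3 (proof)] -/
theorem card_mul_cntn_le (q : Matrix (Fin n) (Fin s) F → Prop) [DecidablePred q]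
    (A : Matrix (Fin n) (Fin s) F) :
    (Finset.univ.filter fun C => q C ∧ C.rank = A.rank).card * cntn A A ≤
      (Finset.univ.filter fun g : Γn F n s => q (actn g A)).card := by
  rw [card_eq_sum_cntn]
  calc (Finset.univ.filter fun C => q C ∧ C.rank = A.rank).card * cntn A A
      = ∑ C ∈ Finset.univ.filter (fun C => q C ∧ C.rank = A.rank), cntn A C := by
        rw [Finset.sum_congr rfl (fun C hC =>
          cntn_eq_of_rank_eq rfl (Finset.mem_filter.1 hC).2.2), Finset.sum_const, smul_eq_mul]
    _ ≤ ∑ C ∈ Finset.univ.filter q, cntn A C :=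
        Finset.sum_le_sum_of_subset fun C hC => by
          simp only [Finset.mem_filter, Finset.mem_univ, true_and] at hC ⊢
          exact hC.1

end CountingN

/-! ## Lemma 6 for general `n`: twisting a computation by `(P, Q)` -/

section TwistN

variable (β : BilinComp (mulBilin F n s m) ι)

/-- `f_t(x) = ∑ x_{il} (A_t)_{il}`. [cite: Nazarov2023FiniteFieldLB, §3 (2)] -/
theorem fn_eq_sum (t : ι) (x : Matrix (Fin n) (Fin s) F) :
    β.f t x = ∑ i, ∑ l, x i l * An β t i l := by
  conv_lhs => rw [Matrix.matrix_eq_sum_single x]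
  simp only [map_sum, An_apply]
  refine Finset.sum_congr rfl fun i _ => Finset.sum_congr rfl fun l _ => ?_
  rw [show Matrix.single i l (x i l) = x i l • Matrix.single i l (1 : F) by
    rw [Matrix.smul_single, smul_eq_mul, mul_one], map_smul, smul_eq_mul]

/-- **Lemma 6**: the computation with `f'_t(x) = f_t(Pᵀ x Qᵀ)`, `g'_t(y) = g_t((Qᵀ)⁻¹ y)`,
`w'_t = (Pᵀ)⁻¹ w_t`. [cite: Nazarov2023FiniteFieldLB, Lemma 6] -/
def twistn (P : Matrix (Fin n) (Fin n) F) (Q : Matrix (Fin s) (Fin s) F) (hP : IsUnit P.det)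
    (hQ : IsUnit Q.det) : BilinComp (mulBilin F n s m) ι :=
  β.comap ((mulLeftLin F P.transpose).comp (mulRightLin F Q.transpose)) (mulLeftLin F (Q.transpose)⁻¹)
    (mulLeftLin F (P.transpose)⁻¹)
    (fun x y => by
      have hP' : IsUnit (Matrix.transpose P).det := Matrix.isUnit_det_transpose P hP
      have hQ' : IsUnit (Matrix.transpose Q).det := Matrix.isUnit_det_transpose Q hQ
      simp only [LinearMap.comp_apply, mulLeftLin_apply, mulRightLin_apply, mulBilin_apply]
      rw [Matrix.mul_assoc P.transpose (x * Q.transpose), Matrix.mul_assoc x Q.transpose,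
        ← Matrix.mul_assoc Q.transpose, Matrix.mul_nonsing_inv _ hQ', Matrix.one_mul,
        ← Matrix.mul_assoc (P.transpose)⁻¹, Matrix.nonsing_inv_mul _ hP', Matrix.one_mul])

/-- The coefficient matrices of the twisted computation are `P A_t Q`. [cite: Nazarov2023FiniteFieldLB, Lemma 6] -/
theorem An_twistn (P : Matrix (Fin n) (Fin n) F) (Q : Matrix (Fin s) (Fin s) F) (hP : IsUnit P.det)
    (hQ : IsUnit Q.det) (t : ι) : An (twistn β P Q hP hQ) t = P * An β t * Q := by
  ext i l
  rw [An_apply, twistn, BilinComp.comap_f, LinearMap.comp_apply, mulRightLin_apply, mulLeftLin_apply,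
    fn_eq_sum]
  have hM : ∀ (p : Fin n) (q : Fin s),
      (P.transpose * ((Matrix.single i l (1 : F) : Matrix (Fin n) (Fin s) F) * Q.transpose)) p q =
        P i p * Q q l := by
    intro p q
    rw [Matrix.mul_apply, Finset.sum_eq_single i (fun i' _ hi' => by
        rw [Matrix.single_mul_apply_of_ne (1 : F) i l i' q hi', mul_zero]) (by simp),
      Matrix.single_mul_apply_same, one_mul, Matrix.transpose_apply, Matrix.transpose_apply]
  simp only [hM, Matrix.mul_apply, Finset.sum_mul]
  rw [Finset.sum_comm]
  exact Finset.sum_congr rfl fun q _ => Finset.sum_congr rfl fun p _ => by ring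

end TwistN

/-! ## The subspace `L*` as a predicate, and the assembly -/

section MainN

/-- Membership in `L*` (`= ⟨V*_{i,j}⟩`): the last row is minus the last column on the first `n − 1`
places and zero beyond: `M_{n c} + [c < n−1] M_{c s} = 0` for every column `c`.
[cite: Nazarov2023FiniteFieldLB, §3 (definition of `L*`)] -/
def InL (hn : 1 ≤ n) (hns : n ≤ s) (M : Matrix (Fin n) (Fin s) F) : Prop :=
  ∀ c : Fin s, M (rowL hn) c + (if h : c.val + 1 < n then M ⟨c.val, by omega⟩ (colL (le_trans hn hns)) else 0) = 0

/-- `a*_t = 0` iff `A_t ∈ L*`. [cite: Nazarov2023FiniteFieldLB, Lemma 7 (proof)] -/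
theorem aSn_eq_zero_iff (β : BilinComp (mulBilin F n s m) ι) (hn : 1 ≤ n) (hns : n ≤ s) (t : ι) :
    aSn β hn hns t = 0 ↔ InL hn hns (An β t) := by
  constructor
  · intro h c
    exact congrFun h c
  · intro h
    funext c
    exact h c

/-- The zero matrix lies in `L*`. [cite: Nazarov2023FiniteFieldLB, §3] -/
theorem inL_zero (hn : 1 ≤ n) (hns : n ≤ s) : InL hn hns (0 : Matrix (Fin n) (Fin s) F) := by
  intro c
  simp

variable [Fintype F] [DecidableEq F]

/-- Membership in `L*` is decidable (classically). [cite: Nazarov2023FiniteFieldLB, §3] -/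
instance (hn : 1 ≤ n) (hns : n ≤ s) : DecidablePred (InL (F := F) hn hns) := Classical.decPred _

/-- **The Theorem from the counts** (source, p. 49: "из лемм 3 и 4 получаем
`d ≥ (n+s−1)m + p₁ d q*₁ + … + p_n d q*_n`"): if every rank class `r ≤ n` satisfies
`b · R_r ≤ a · v*_r` (`v*_r` = the number of rank-`r` matrices in `L*`), then every bilinear computation
of `⟨n,s,m⟩` with `d` terms satisfies `a (n + s − 1) m + b d ≤ a d`.
[cite: Nazarov2023FiniteFieldLB, Theorem (proof, p. 49) with Lemmas 3–7] -/
theorem card_ge_of_count (hn : 2 ≤ n) (hns : n ≤ s) (a b : ℕ)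
    (hyp : ∀ r : ℕ, r ≤ n →
      b * (Finset.univ.filter fun C : Matrix (Fin n) (Fin s) F => C.rank = r).card ≤
        a * (Finset.univ.filter fun C : Matrix (Fin n) (Fin s) F =>
          InL (by omega : 1 ≤ n) hns C ∧ C.rank = r).card)
    (β : BilinComp (mulBilin F n s m) ι) :
    a * ((n + s - 1) * m) + b * Fintype.card ι ≤ a * Fintype.card ι := by
  classical
  have hn1 : 1 ≤ n := by omega
  let As := An β
  let G := Fintype.card (Γn F n s)
  -- Lemma 3: a good twist
  obtain ⟨g, hg⟩ := exists_goodn As (InL (F := F) hn1 hns)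
  let β1 := twistn β (g.1 : Matrix (Fin n) (Fin n) F) (g.2 : Matrix (Fin s) (Fin s) F)
    (Matrix.isUnits_det_units g.1) (Matrix.isUnits_det_units g.2)
  have hZ : (Finset.univ.filter fun t => aSn β1 hn1 hns t = 0) =
      Finset.univ.filter fun t => InL hn1 hns (actn g (As t)) := by
    ext t
    simp only [Finset.mem_filter, Finset.mem_univ, true_and, aSn_eq_zero_iff, β1, An_twistn, actn_def, As]
  -- Lemma 7 (general `n`) for the twisted computation
  have hL7 := typeStar_bound_general β1 hn hns
  rw [hZ] at hL7
  -- every term contributes at least `(b/a) |G|`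
  have hterm : ∀ t : ι, b * G ≤
      a * (Finset.univ.filter fun g' : Γn F n s => InL hn1 hns (actn g' (As t))).card := by
    intro t
    have hr : (As t).rank ≤ n := by
      have := Matrix.rank_le_card_height (As t)
      simpa using this
    have h1 := card_mul_cntn_le (InL (F := F) hn1 hns) (As t)
    have h2 := card_mul_cntn (F := F) (As t)
    have h3 := hyp (As t).rank hr
    -- `b |G| = b R_r N ≤ a v_r N ≤ a #{g' : g' A_t ∈ L*}`
    calc b * G = b * ((Finset.univ.filter fun C : Matrix (Fin n) (Fin s) F =>
          C.rank = (As t).rank).card * cntn (As t) (As t)) := by rw [h2]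
      _ ≤ a * ((Finset.univ.filter fun C : Matrix (Fin n) (Fin s) F =>
          InL hn1 hns C ∧ C.rank = (As t).rank).card * cntn (As t) (As t)) := by
          rw [← mul_assoc, ← mul_assoc]; exact Nat.mul_le_mul_right _ h3
      _ ≤ a * (Finset.univ.filter fun g' : Γn F n s => InL hn1 hns (actn g' (As t))).card :=
          Nat.mul_le_mul_left _ h1
  have hsum : Fintype.card ι * (b * G) ≤
      a * ∑ t : ι, (Finset.univ.filter fun g' : Γn F n s => InL hn1 hns (actn g' (As t))).card := by
    rw [Finset.mul_sum, ← smul_eq_mul, ← Finset.card_univ]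
    exact Finset.card_nsmul_le_sum _ _ _ fun t _ => hterm t
  have hG : 0 < G := Fintype.card_pos
  -- combine: `d b |G| ≤ a k |G|` and `(n+s-1) m + k ≤ d`
  have hk := hsum.trans (Nat.mul_le_mul_left a hg)
  have hk' : Fintype.card ι * b ≤
      a * (Finset.univ.filter fun t => InL hn1 hns (actn g (As t))).card := by
    have : Fintype.card ι * b * G ≤
        a * (Finset.univ.filter fun t => InL hn1 hns (actn g (As t))).card * G := by
      rw [mul_assoc, mul_assoc]; exact hk
    exact Nat.le_of_mul_le_mul_right this hG
  nlinarith [hk', hL7]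

end MainN

end Nazarov2023

open Nazarov2023 in
/-- **Nazarov's Theorem from the rank-class counts of `L*`** (any `2 ≤ n ≤ s`, any finite field): if
`b · R_r^{(n,s)} ≤ a · v*_r` for every `r ≤ n` and some `0 < b < a` (`q*_r ≥ b/a`), then
`R_F(⟨n,s,m⟩) ≥ (n + s − 1)(1 + 1/(a/b − 1)) m`. Lemma 2 of the source (`q*_r ≥ 1/f(K,n,s)`, `n ≥ 3`)
turns this into the Theorem; it is the one ingredient not formalised in the tree.
[cite: Nazarov2023FiniteFieldLB, Theorem (proof, p. 49)] -/
theorem nazarov2023_rank_matMulTensor_ge_of_count (F : Type*) [Field F] [Fintype F] [DecidableEq F]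
    {n s : ℕ} (hn : 2 ≤ n) (hns : n ≤ s) (a b : ℕ) (hb : 0 < b) (hab : b < a)
    (hyp : ∀ r : ℕ, r ≤ n →
      b * (Finset.univ.filter fun C : Matrix (Fin n) (Fin s) F => C.rank = r).card ≤
        a * (Finset.univ.filter fun C : Matrix (Fin n) (Fin s) F =>
          InL (by omega : 1 ≤ n) hns C ∧ C.rank = r).card)
    (m : ℕ) :
    ((n + s - 1 : ℕ) : ℚ) * (1 + 1 / ((a : ℚ) / b - 1)) * m ≤ (tensorRank (matMulTensor F n s m) : ℚ) := by
  classical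
  obtain ⟨β⟩ := exists_bilinComp_of_tensorRank_le (k := F) (c := n) (m := s) (n := m) le_rfl
  have h := card_ge_of_count hn hns a b hyp β
  rw [Fintype.card_fin] at h
  have hq : ((a : ℚ) * (((n + s - 1 : ℕ) : ℚ) * m) + b * (tensorRank (matMulTensor F n s m) : ℚ)) ≤
      a * (tensorRank (matMulTensor F n s m) : ℚ) := by exact_mod_cast h
  have hb' : (0 : ℚ) < b := by exact_mod_cast hb
  have hab' : (b : ℚ) < a := by exact_mod_cast hab
  have hne : (a : ℚ) - b ≠ 0 := ne_of_gt (by linarith)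
  have hbne : (b : ℚ) ≠ 0 := ne_of_gt hb'
  have e : (1 + 1 / ((a : ℚ) / b - 1)) = a / (a - b) := by
    have h1 : (a : ℚ) / b - 1 = ((a : ℚ) - b) / b := by field_simp
    rw [h1, one_div_div, eq_div_iff hne, add_mul, div_mul_cancel₀ _ hne]
    ring
  rw [e]
  rw [show ((n + s - 1 : ℕ) : ℚ) * ((a : ℚ) / (a - b)) * m =
      (a * (((n + s - 1 : ℕ) : ℚ) * m)) / (a - b) by ring]
  rw [div_le_iff₀ (by linarith)]
  nlinarith [hq]

end Literature.Computability.AlgebraicComplexity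

end
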